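import Summits.ValiantsHypothesis.ValiantsHypothesis.Theorems.GrenetZeonHessianRankCodimTwoLatinPlane
import Summits.ValiantsHypothesis.ValiantsHypothesis.Theorems.GrenetZeonHessianRankCodimTwoReduceModP
import HarnessLib

/-!
# Theorem P, PART C: the characteristic-`p` elimination and the (interface-abstract) assembly

Crux `HessianRankCodimTwo` (stmt-ValiantsHypothesis-8061), line `good_plane` v2, Theorem P
(`Cruxes/HessianRankCodimTwo/GoodPlanesLatinReduction.md` §6, §8): the Latin block plane is good for
every prime block size.  This file is PART C of the three-seat split (A = Frobenius congruences
[8061-p3], B = table/fibre identities [8061-p4], C = elimination + assembly [8061-p2]):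

* `latin_elim_core` — over a field in which `2 ≠ 0`: `F(w) = 0`, `w₀ = 0 ∨ P₀(w) = 0`,
  `w₁ = 0 ∨ P₁(w) = 0` force `w = 0`, where `F = w₀³+w₁³+w₂³+3w₀w₁w₂`, `P₀ = w₀²+w₁w₂`,
  `P₁ = w₁²+w₂w₀` (key identity: `2 w₀⁶ ∈ (P₀, P₁, F)`); `latin_elim` — the same for any two
  distinct differences `d ≠ d'` (cyclic relabelling).
* `exists_two_differences` — if at least four of the nine block values vanish, two of them have
  distinct differences `J − I`.
* `latinBlockNonvanishing_of_congruences` — **assembly**: given integer polynomials `Φ`, `Ψ I J`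
  (homogeneous) that vanish at the coordinates of a point of the Latin plane whenever the
  permanent, resp. the block value `(I, J)`, vanishes there (PART B), and whose evaluations over
  every field of characteristic `p` are `F(w)^p`, resp. `w_{J-I}^{p-2} P_{J-I}(w)^p` (PART A), the
  residual statement `LatinBlockNonvanishing p 0` holds (via `exists_charP_commonZero`, landed);
  `goodPlane_three_mul_prime_of_congruences` — hence `GoodPlane (3p)` (unfolded) for `p ≥ 13`.

The concrete instantiation with PART A/B's `latinPhi`, `latinPsi` is a one-liner once those files
are in the tree.  VP ≠ VNP is not moved: the crux only feeds the constant-factor bound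
`TwoDimCoefficients`.
-/

noncomputable section

open MvPolynomial Finset
open Literature.Computability.AlgebraicComplexity

-- single-conjunct layout `Summits/ValiantsHypothesis/ValiantsHypothesis`: duplicated namespace by design
set_option linter.dupNamespace false

namespace Summit.ValiantsHypothesis.ValiantsHypothesis.Theorems.GrenetZeonHessianRankCodimTwo

/-! ### The elimination over a field of characteristic `≠ 2` -/

section Elim

variable {L : Type*} [Field L]

/-- **Core elimination.** `F = A³+B³+C³+3ABC = 0`, `A = 0 ∨ A²+BC = 0`, `B = 0 ∨ B²+CA = 0` and
`2 ≠ 0` force `A = B = C = 0`.  Key identity in the last case: `2A⁶ ∈ (A²+BC, B²+CA, F)`.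
[folklore] -/
theorem latin_elim_core (h2 : (2 : L) ≠ 0) {A B C : L}
    (hF : A ^ 3 + B ^ 3 + C ^ 3 + 3 * (A * B * C) = 0)
    (hA : A = 0 ∨ A ^ 2 + B * C = 0) (hB : B = 0 ∨ B ^ 2 + C * A = 0) :
    A = 0 ∧ B = 0 ∧ C = 0 := by
  -- first `A = 0`
  have hA0 : A = 0 := by
    rcases hA with hA | hA
    · exact hA
    rcases hB with hB | hB
    · -- `B = 0`: `A² = 0`
      rw [hB, zero_mul, add_zero] at hA
      exact pow_eq_zero_iff (n := 2) (by norm_num) |>.mp hA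
    · -- both quadrics vanish: `2 A⁶ = 0`
      have h1 : C ^ 3 * A ^ 3 + B ^ 6 = 0 := by
        linear_combination (C ^ 2 * A ^ 2 - C * A * B ^ 2 + B ^ 4) * hB
      have h2' : B ^ 3 - A ^ 3 = 0 := by
        linear_combination B * hB - A * hA
      have h3 : C ^ 3 - A ^ 3 = 0 := by
        linear_combination hF - B * hB - 2 * A * hA
      have h4 : 2 * A ^ 6 = 0 := by
        linear_combination h1 - A ^ 3 * h3 - (B ^ 3 + A ^ 3) * h2'
      have h5 : A ^ 6 = 0 := by
        rcases mul_eq_zero.mp h4 with h | h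
        · exact absurd h h2
        · exact h
      exact pow_eq_zero_iff (n := 6) (by norm_num) |>.mp h5
  subst hA0
  have hB0 : B = 0 := by
    rcases hB with hB | hB
    · exact hB
    · rw [mul_zero, add_zero] at hB
      exact pow_eq_zero_iff (n := 2) (by norm_num) |>.mp hB
  subst hB0
  refine ⟨rfl, rfl, ?_⟩
  have : C ^ 3 = 0 := by linear_combination hF
  exact pow_eq_zero_iff (n := 3) (by norm_num) |>.mp this

/-- **Elimination for two distinct differences.** With `P_d(w) = w_d² + w_{d+1} w_{d+2}`: if
`F(w) = 0` and, for two distinct `d ≠ d'`, `w_d = 0 ∨ P_d(w) = 0` and `w_{d'} = 0 ∨ P_{d'}(w) = 0`,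
then `w = 0` (provided `2 ≠ 0`). [folklore] -/
theorem latin_elim (h2 : (2 : L) ≠ 0) (w : Fin 3 → L)
    (hF : w 0 ^ 3 + w 1 ^ 3 + w 2 ^ 3 + 3 * (w 0 * w 1 * w 2) = 0)
    {d d' : Fin 3} (hdd : d ≠ d')
    (hd : w d = 0 ∨ w d ^ 2 + w (d + 1) * w (d + 2) = 0)
    (hd' : w d' = 0 ∨ w d' ^ 2 + w (d' + 1) * w (d' + 2) = 0) : w = 0 := by
  have key : w 0 = 0 ∧ w 1 = 0 ∧ w 2 = 0 := by
    fin_cases d <;> fin_cases d'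
    all_goals (first | exact absurd rfl hdd | skip)
    · -- (0,1): A = w0, B = w1, C = w2
      exact latin_elim_core h2 hF hd (by simpa [mul_comm] using hd')
    · -- (0,2): A = w2, B = w0, C = w1  (P₂ = w2² + w0 w1 = A²+BC, P₀ = w0² + w1 w2 = B² + CA)
      have h := latin_elim_core h2 (A := w 2) (B := w 0) (C := w 1) (by linear_combination hF)
        (by simpa [mul_comm] using hd') (by simpa [mul_comm] using hd)
      exact ⟨h.2.1, h.2.2, h.1⟩
    · -- (1,0)
      have h := latin_elim_core h2 hF hd' (by simpa [mul_comm] using hd)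
      exact h
    · -- (1,2): A = w1, B = w2, C = w0
      have h := latin_elim_core h2 (A := w 1) (B := w 2) (C := w 0) (by linear_combination hF)
        (by simpa [mul_comm] using hd) (by simpa [mul_comm] using hd')
      exact ⟨h.2.2, h.1, h.2.1⟩
    · -- (2,0): A = w2, B = w0, C = w1
      have h := latin_elim_core h2 (A := w 2) (B := w 0) (C := w 1) (by linear_combination hF)
        (by simpa [mul_comm] using hd) (by simpa [mul_comm] using hd')
      exact ⟨h.2.1, h.2.2, h.1⟩
    · -- (2,1): A = w1, B = w2, C = w0
      have h := latin_elim_core h2 (A := w 1) (B := w 2) (C := w 0) (by linear_combination hF)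
        (by simpa [mul_comm] using hd') (by simpa [mul_comm] using hd)
      exact ⟨h.2.2, h.1, h.2.1⟩
  funext i
  fin_cases i
  · exact key.1
  · exact key.2.1
  · exact key.2.2

end Elim

/-! ### Counting: four vanishing block values give two distinct differences -/

/-- If a set of pairs `(I, J) ∈ Fin 3 × Fin 3` has at least four elements, it contains two
pairs with distinct differences `J - I`. [folklore] -/
theorem exists_two_differences (Z : Finset (Fin 3 × Fin 3)) (hZ : 4 ≤ Z.card) :
    ∃ z ∈ Z, ∃ z' ∈ Z, z.2 - z.1 ≠ z'.2 - z'.1 := by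
  by_contra h
  push Not at h
  have hne : Z.Nonempty := Finset.card_pos.mp (by omega)
  obtain ⟨z₀, hz₀⟩ := hne
  -- all differences equal `d₀ := z₀.2 - z₀.1`; so `Z ⊆ {(I, I + d₀)}`
  have hsub : Z ⊆ Finset.univ.image fun I : Fin 3 => (I, I + (z₀.2 - z₀.1)) := by
    intro z hz
    simp only [Finset.mem_image, Finset.mem_univ, true_and]
    refine ⟨z.1, ?_⟩
    have := h z hz z₀ hz₀
    rw [← this]
    ext <;> simp
  have := (Finset.card_le_card hsub).trans Finset.card_image_le
  rw [Finset.card_univ, Fintype.card_fin] at this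
  omega

/-! ### Assembly -/

section Assembly

variable {p : ℕ}

/-- **Theorem P, assembly from the congruences (PART C).**  Let `p ≥ 3` be prime.  Suppose
integer polynomials `Φ` and `Ψ I J` in three variables are given, homogeneous, such that
(PART B) `Φ` vanishes at the coordinates `a` of every point of the Latin plane (`r = 0`) with
vanishing permanent, and `Ψ I J` at every point with vanishing block value `(I, J)`; and (PART A)
over every field `L` of characteristic `p`, `Φ(w) = F(w)^p` and
`Ψ I J (w) = w_{J-I}^{p-2} · P_{J-I}(w)^p`.  Then `LatinBlockNonvanishing p 0`: at every point of
the plane on the permanental hypersurface at least six block values are non-zero.  Proof: else two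
vanishing values with distinct differences; reduce the common zero of `Φ, Ψ, Ψ'` mod `p`
(`exists_charP_commonZero`) and eliminate (`latin_elim`). [folklore] -/
theorem latinBlockNonvanishing_of_congruences (hp : p.Prime) (h3 : 3 ≤ p)
    (Φ : MvPolynomial (Fin 3) ℤ) (Ψ : Fin 3 → Fin 3 → MvPolynomial (Fin 3) ℤ)
    (dΦ : ℕ) (dΨ : ℕ) (hΦhom : Φ.IsHomogeneous dΦ) (hΨhom : ∀ I J, (Ψ I J).IsHomogeneous dΨ)
    (hΦ : ∀ a : Fin 3 → ℂ,
      MvPolynomial.eval (latinPoint p 0 a) (perPoly (Fin (3 * p + 0)) ℂ) = 0 → aeval a Φ = 0)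
    (hΨ : ∀ (hm : 2 ≤ p) (a : Fin 3 → ℂ) (I J : Fin 3),
      latinBlockValue p 0 hm a I J = 0 → aeval a (Ψ I J) = 0)
    (hΦp : ∀ (L : Type) [Field L] [CharP L p] (w : Fin 3 → L),
      aeval w Φ = (w 0 ^ 3 + w 1 ^ 3 + w 2 ^ 3 + 3 * (w 0 * w 1 * w 2)) ^ p)
    (hΨp : ∀ (L : Type) [Field L] [CharP L p] (w : Fin 3 → L) (I J : Fin 3),
      aeval w (Ψ I J) = w (J - I) ^ (p - 2) * (w (J - I) ^ 2 + w (J - I + 1) * w (J - I + 2)) ^ p) :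
    LatinBlockNonvanishing p 0 := by
  classical
  intro hm a ha hper
  by_contra hlt
  push Not at hlt
  -- the vanishing block values
  set Z := Finset.univ.filter fun IJ : Fin 3 × Fin 3 => latinBlockValue p 0 hm a IJ.1 IJ.2 = 0
    with hZ
  have hZcard : 4 ≤ Z.card := by
    have hsplit := Finset.card_filter_add_card_filter_not
      (s := (Finset.univ : Finset (Fin 3 × Fin 3)))
      (fun IJ : Fin 3 × Fin 3 => latinBlockValue p 0 hm a IJ.1 IJ.2 = 0)
    rw [Finset.card_univ, Fintype.card_prod, Fintype.card_fin, ← hZ] at hsplit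
    have : (Finset.univ.filter fun IJ : Fin 3 × Fin 3 => ¬ latinBlockValue p 0 hm a IJ.1 IJ.2 = 0) =
        Finset.univ.filter fun IJ : Fin 3 × Fin 3 => latinBlockValue p 0 hm a IJ.1 IJ.2 ≠ 0 := rfl
    rw [this] at hsplit
    omega
  obtain ⟨z, hz, z', hz', hzz⟩ := exists_two_differences Z hZcard
  simp only [hZ, Finset.mem_filter, Finset.mem_univ, true_and] at hz hz'
  -- the three integer forms with the common zero `a`
  let f : Fin 3 → MvPolynomial (Fin 3) ℤ := ![Φ, Ψ z.1 z.2, Ψ z'.1 z'.2]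
  let d : Fin 3 → ℕ := ![dΦ, dΨ, dΨ]
  have hfhom : ∀ t, (f t).IsHomogeneous (d t) := by
    intro t; fin_cases t
    · exact hΦhom
    · exact hΨhom _ _
    · exact hΨhom _ _
  have hfzero : ∀ t, aeval a (f t) = 0 := by
    intro t; fin_cases t
    · exact hΦ a hper
    · exact hΨ hm a _ _ hz
    · exact hΨ hm a _ _ hz'
  obtain ⟨L, _instF, _instC, w, hw, hfw⟩ := exists_charP_commonZero f d hfhom a ha hfzero p hp
  -- characteristic `p ≥ 3`: `2 ≠ 0`
  have h2 : (2 : L) ≠ 0 := by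
    intro h
    have h2' : ((2 : ℕ) : L) = 0 := by exact_mod_cast h
    rw [CharP.cast_eq_zero_iff L p] at h2'
    have := Nat.le_of_dvd (by norm_num) h2'
    omega
  -- read off the congruences
  have hF : w 0 ^ 3 + w 1 ^ 3 + w 2 ^ 3 + 3 * (w 0 * w 1 * w 2) = 0 := by
    have := hfw 0
    simp only [f, Matrix.cons_val_zero] at this
    rw [hΦp L w] at this
    exact pow_eq_zero_iff (n := p) (by omega) |>.mp this
  have hval : ∀ (I J : Fin 3), aeval w (Ψ I J) = 0 →
      w (J - I) = 0 ∨ w (J - I) ^ 2 + w (J - I + 1) * w (J - I + 2) = 0 := by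
    intro I J h
    rw [hΨp L w I J] at h
    rcases mul_eq_zero.mp h with h | h
    · by_cases hp2 : p - 2 = 0
      · rw [hp2, pow_zero] at h; exact absurd h one_ne_zero
      · exact Or.inl (pow_eq_zero_iff (n := p - 2) hp2 |>.mp h)
    · exact Or.inr (pow_eq_zero_iff (n := p) (by omega) |>.mp h)
  have hd := hval z.1 z.2 (by have := hfw 1; simpa [f] using this)
  have hd' := hval z'.1 z'.2 (by have := hfw 2; simpa [f] using this)
  exact hw (latin_elim h2 w hF hzz hd hd')

/-- **GoodPlane(3p) for primes `p ≥ 13`, from the congruences.** [folklore] -/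
theorem goodPlane_three_mul_prime_of_congruences (hp : p.Prime) (h13 : 13 ≤ p)
    (Φ : MvPolynomial (Fin 3) ℤ) (Ψ : Fin 3 → Fin 3 → MvPolynomial (Fin 3) ℤ)
    (dΦ : ℕ) (dΨ : ℕ) (hΦhom : Φ.IsHomogeneous dΦ) (hΨhom : ∀ I J, (Ψ I J).IsHomogeneous dΨ)
    (hΦ : ∀ a : Fin 3 → ℂ,
      MvPolynomial.eval (latinPoint p 0 a) (perPoly (Fin (3 * p + 0)) ℂ) = 0 → aeval a Φ = 0)
    (hΨ : ∀ (hm : 2 ≤ p) (a : Fin 3 → ℂ) (I J : Fin 3),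
      latinBlockValue p 0 hm a I J = 0 → aeval a (Ψ I J) = 0)
    (hΦp : ∀ (L : Type) [Field L] [CharP L p] (w : Fin 3 → L),
      aeval w Φ = (w 0 ^ 3 + w 1 ^ 3 + w 2 ^ 3 + 3 * (w 0 * w 1 * w 2)) ^ p)
    (hΨp : ∀ (L : Type) [Field L] [CharP L p] (w : Fin 3 → L) (I J : Fin 3),
      aeval w (Ψ I J) = w (J - I) ^ (p - 2) * (w (J - I) ^ 2 + w (J - I + 1) * w (J - I + 2)) ^ p) :
    ∃ w : Fin 3 → (Fin (3 * p + 0) × Fin (3 * p + 0) → ℂ), LinearIndependent ℂ w ∧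
      ∀ a : Fin 3 → ℂ, a ≠ 0 →
        MvPolynomial.eval (∑ i, a i • w i) (perPoly (Fin (3 * p + 0)) ℂ) = 0 →
        (3 * p + 0) ^ 2 <
          2 * (hess0 (transl (∑ i, a i • w i) (perPoly (Fin (3 * p + 0)) ℂ))).rank :=
  goodPlane_of_latinBlockNonvanishing (by omega) (by norm_num)
    (latinBlockNonvanishing_of_congruences hp (by omega) Φ Ψ dΦ dΨ hΦhom hΨhom hΦ hΨ hΦp hΨp)

end Assembly

end Summit.ValiantsHypothesis.ValiantsHypothesis.Theorems.GrenetZeonHessianRankCodimTwo
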